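import Mathlib
import Summits.CriticalPhenomena.PercolationContinuityZ3.Theorems.PercNearOneGluingNoHeavyLowerTailCondCILSteinerPathBase
import HarnessLib

/-!
# `NoHeavyLowerTail` (stmt-CriticalPhenomena-4575) — CONDITIONAL cumulative isolation for Steiner paths, II:
# the induction over the path pairs

Seat `prim-cplus-engine` gen 7, 2026-08-19 (`--supports stmt-CriticalPhenomena-4575`).  No definitions, no named facts,
no sorries.  Sequel of `…CondCILSteinerPathBase.lean`.

* `CondCIL.condCIL_steinerPath` — for an injective Steiner path `p : Fin (k+1) → Fin n` off `A` (positive-weight non-relay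
  neighbours of `p i` other than `p i` are path neighbours; hairs arbitrary) whose PATH pairs `s(p l, p (l+1))` all have
  weight `≤ 1/2` or `= 1`, and every champion `c`:
      `μ(1 ≤ N_{p 0} ≤ j) ≤ 6 · μ(p 0 ↔ A) · μ(N_c ≤ j)`.
  PROOF.  Induction on the number `d` of path pairs of weight `< 1`.  `d = 0`: `CondCIL.condCIL_chain`.  Step: let `e` be
  the FIRST path pair of weight `< 1` (so `≤ 1/2`).  On `{e open}` the conditional law is `μ_{w[e ↦ 1]}`, the same path
  has one fewer pair of weight `< 1`, the lightness of every relay only decreases, and `μ(e open)·μ_{w[e↦1]}(p 0 ↔ A) =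
  μ(p 0 ↔ A, e open)`: induction.  On `{e closed}` the conditional law is `μ_{w[e ↦ 0]}`, under which the prefix up to
  `e` is a weight-one chain with relay hairs (base case), the lightness of a relay at most doubles
  (`ObserverUnionBoundG.pinW_single_real_mul_le`, `w e ≤ 1/2`), and `μ(e closed)·μ_{w[e↦0]}(p 0 ↔ A) = μ(p 0 ↔ A, e closed)`.
  Adding: `6 M (μ(att, e open) + μ(att, e closed)) = 6 M μ(att)`.
* `CondCIL.condCIL_steinerPath_exists` — the `∃ a ∈ A` shape.

USE (`…MarkovFirstEdgeSpider.lean`, READING): with this, the Markov spider bound needs no reliability hypothesis on the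
legs — `Σ_x α_x · bad^{G∖ox}(x) ≤ 12 M Σ_x α_x v_x ≤ 17 M log(1/δ₀)` — see `…MarkovFirstEdgeSpiderUniform.lean`.
-/

namespace Summit.CriticalPhenomena.PercolationContinuityZ3.Theorems

open MeasureTheory Set
open Literature.Probability.LatticeModels (prodBernoulli prodBernoulli_real_setOf_mem prodBernoulli_real_setOf_notMem
  prodBernoulli_real_mono_of_isUpperSet)
open Literature.Probability.Percolation

noncomputable section
open Classical

variable {n : ℕ}

namespace CondCIL

/-- The cylinder of the single pair `e` with pattern "open" is `{e ∈ ω}`. [folklore] -/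
theorem localCylinder_singleton_self (e : Sym2 (Fin n)) :
    localCylinder ({e} : Set (Sym2 (Fin n))) ({e} : Set (Sym2 (Fin n))) = {ω : BondConfig (Fin n) | e ∈ ω} := by
  ext ω
  simp only [localCylinder, mem_singleton_iff, forall_eq, iff_true, mem_setOf_eq]

/-- The cylinder of the single pair `e` with pattern "closed" is `{e ∉ ω}`. [folklore] -/
theorem localCylinder_singleton_empty (e : Sym2 (Fin n)) :
    localCylinder ({e} : Set (Sym2 (Fin n))) (∅ : Set (Sym2 (Fin n))) = {ω : BondConfig (Fin n) | e ∉ ω} := by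
  ext ω
  simp only [localCylinder, mem_singleton_iff, forall_eq, mem_empty_iff_false, iff_false, mem_setOf_eq]

/-- **Conditioning on one pair**: `μ_w(S ∩ {e open}) = w(e) · μ_{w[e ↦ 1]}(S)`. [folklore] -/
theorem real_inter_open_eq (w : Sym2 (Fin n) → unitInterval) (S : Set (BondConfig (Fin n))) (e : Sym2 (Fin n)) :
    (prodBernoulli w).real (S ∩ {ω : BondConfig (Fin n) | e ∈ ω}) =
      (w e : ℝ) * (prodBernoulli (pinW w ({e} : Set (Sym2 (Fin n))) ({e} : Set (Sym2 (Fin n))))).real S := by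
  have key := prodBernoulli_real_inter_localCylinder w ({e} : Finset (Sym2 (Fin n))) ({e} : Set (Sym2 (Fin n)))
    (A := S) MeasurableSet.of_discrete
  rw [Finset.coe_singleton, localCylinder_singleton_self, prodBernoulli_real_setOf_mem] at key
  exact key

/-- **Conditioning on one pair**: `μ_w(S ∩ {e closed}) = (1 − w(e)) · μ_{w[e ↦ 0]}(S)`. [folklore] -/
theorem real_inter_closed_eq (w : Sym2 (Fin n) → unitInterval) (S : Set (BondConfig (Fin n))) (e : Sym2 (Fin n)) :
    (prodBernoulli w).real (S ∩ {ω : BondConfig (Fin n) | e ∉ ω}) =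
      (1 - (w e : ℝ)) * (prodBernoulli (pinW w ({e} : Set (Sym2 (Fin n))) ∅)).real S := by
  have key := prodBernoulli_real_inter_localCylinder w ({e} : Finset (Sym2 (Fin n))) (∅ : Set (Sym2 (Fin n)))
    (A := S) MeasurableSet.of_discrete
  rw [Finset.coe_singleton, localCylinder_singleton_empty, prodBernoulli_real_setOf_notMem] at key
  exact key

/-- Pinning a pair OPEN only lowers the lightness `μ(N_a ≤ j)` of every relay. [folklore] -/
theorem light_pinOpen_le (w : Sym2 (Fin n) → unitInterval) (A : Finset (Fin n)) (a : Fin n) (j : ℕ) (e : Sym2 (Fin n)) :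
    (prodBernoulli (pinW w ({e} : Set (Sym2 (Fin n))) ({e} : Set (Sym2 (Fin n))))).real
        {ω : BondConfig (Fin n) | (A.filter fun z => ω ∈ openConn a z).card ≤ j} ≤
      (prodBernoulli w).real {ω : BondConfig (Fin n) | (A.filter fun z => ω ∈ openConn a z).card ≤ j} := by
  set L : Set (BondConfig (Fin n)) := {ω | (A.filter fun z => ω ∈ openConn a z).card ≤ j} with hL
  have hle : w ≤ pinW w ({e} : Set (Sym2 (Fin n))) ({e} : Set (Sym2 (Fin n))) := by
    intro i
    by_cases hi : i ∈ ({e} : Set (Sym2 (Fin n)))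
    · rw [pinW_apply_of_mem_of_mem w hi hi]; exact unitInterval.le_one'
    · rw [pinW_apply_of_not_mem w _ hi]
  have hup : IsUpperSet Lᶜ := fun ω ω' hωω' hω hω' => hω (PrefixPacking.isLowerSet_cardLe A a j hωω' hω')
  have hmono := prodBernoulli_real_mono_of_isUpperSet hle hup MeasurableSet.of_discrete
  rw [probReal_compl_eq_one_sub MeasurableSet.of_discrete, probReal_compl_eq_one_sub MeasurableSet.of_discrete]
    at hmono
  linarith

/-- Two path pairs of an injective path coincide only if their indices do. [folklore] -/
theorem chainPair_injective {k : ℕ} (p : Fin (k + 1) → Fin n) (hpinj : Function.Injective p) :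
    Function.Injective fun l : Fin k => s(p l.castSucc, p l.succ) := by
  intro l l' h
  simp only at h
  rcases Sym2.eq_iff.1 h with ⟨h1, -⟩ | ⟨h1, h2⟩
  · exact Fin.castSucc_injective _ (hpinj h1)
  · have a := congrArg Fin.val (hpinj h1)
    have b := congrArg Fin.val (hpinj h2)
    simp only [Fin.val_castSucc, Fin.val_succ] at a b
    omega

/-- **Conditional cumulative isolation along a Steiner path.**  `p : Fin (k+1) → Fin n` injective, all `p i ∉ A`,
every positive-weight non-relay neighbour `v ≠ p i` of `p i` is a path neighbour `p l`, `|l − i| = 1`; every PATH pair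
has weight `≤ 1/2` or `= 1`; `d` = the number of path pairs of weight `< 1`.  Then for every champion `c` of `w`:
`μ(1 ≤ N_{p 0} ≤ j) ≤ 6 · μ(p 0 ↔ A) · μ(N_c ≤ j)`. [this work] -/
theorem condCIL_steinerPath (A : Finset (Fin n)) (j : ℕ) :
    ∀ (d k : ℕ) (w : Sym2 (Fin n) → unitInterval) (p : Fin (k + 1) → Fin n),
      Function.Injective p → (∀ i, p i ∉ A) →
      (∀ (i : Fin (k + 1)) (v : Fin n), v ∉ A → v ≠ p i → 0 < (w s(p i, v) : ℝ) →
        ∃ l : Fin (k + 1), v = p l ∧ (l.val = i.val + 1 ∨ i.val = l.val + 1)) →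
      (Finset.univ.filter fun l : Fin k => (w s(p l.castSucc, p l.succ) : ℝ) < 1).card = d →
      (∀ l : Fin k, (w s(p l.castSucc, p l.succ) : ℝ) ≤ 1 / 2 ∨ w s(p l.castSucc, p l.succ) = 1) →
      ∀ c ∈ A, (∀ a ∈ A,
        (prodBernoulli w).real {ω : BondConfig (Fin n) | (A.filter fun z => ω ∈ openConn a z).card ≤ j} ≤
          (prodBernoulli w).real {ω : BondConfig (Fin n) | (A.filter fun z => ω ∈ openConn c z).card ≤ j}) →
      (prodBernoulli w).real {ω : BondConfig (Fin n) |
          1 ≤ (A.filter fun z => ω ∈ openConn (p 0) z).card ∧ (A.filter fun z => ω ∈ openConn (p 0) z).card ≤ j} ≤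
        6 * (prodBernoulli w).real (⋃ a ∈ A, (openConn (p 0) a : Set (BondConfig (Fin n)))) *
          (prodBernoulli w).real {ω : BondConfig (Fin n) | (A.filter fun z => ω ∈ openConn c z).card ≤ j} := by
  intro d
  induction d with
  | zero =>
    intro k w p hpinj hpA hpath hd hhalf c hc hchamp
    -- every path pair has weight `1`
    have hone : ∀ l : Fin k, w s(p l.castSucc, p l.succ) = 1 := by
      intro l
      rcases hhalf l with h | h
      · exfalso
        have hmem : l ∈ (Finset.univ.filter fun l : Fin k => (w s(p l.castSucc, p l.succ) : ℝ) < 1) :=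
          Finset.mem_filter.2 ⟨Finset.mem_univ _, by linarith⟩
        rw [Finset.card_eq_zero] at hd
        rw [hd] at hmem
        exact Finset.notMem_empty l hmem
      · exact h
    have h3 := condCIL_chain w A j p hpinj hpA hpath hone c hc hchamp
    have hnn : 0 ≤ (prodBernoulli w).real (⋃ a ∈ A, (openConn (p 0) a : Set (BondConfig (Fin n)))) *
        (prodBernoulli w).real {ω : BondConfig (Fin n) | (A.filter fun z => ω ∈ openConn c z).card ≤ j} :=
      mul_nonneg measureReal_nonneg measureReal_nonneg
    nlinarith
  | succ d ih =>
    intro k w p hpinj hpA hpath hd hhalf c hc hchamp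
    set μ := prodBernoulli w with hμ
    set bad : Set (BondConfig (Fin n)) := {ω | 1 ≤ (A.filter fun z => ω ∈ openConn (p 0) z).card ∧
      (A.filter fun z => ω ∈ openConn (p 0) z).card ≤ j} with hbad
    set att : Set (BondConfig (Fin n)) := ⋃ a ∈ A, (openConn (p 0) a : Set (BondConfig (Fin n))) with hatt
    set M : ℝ := μ.real {ω : BondConfig (Fin n) | (A.filter fun z => ω ∈ openConn c z).card ≤ j} with hM
    have hM0 : 0 ≤ M := measureReal_nonneg
    have hA : A.Nonempty := ⟨c, hc⟩
    -- the first path pair of weight `< 1`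
    set D : Finset (Fin k) := Finset.univ.filter fun l : Fin k => (w s(p l.castSucc, p l.succ) : ℝ) < 1 with hD
    have hDne : D.Nonempty := by rw [← Finset.card_pos, hd]; exact Nat.succ_pos d
    set l₀ : Fin k := D.min' hDne with hl₀
    have hl₀D : l₀ ∈ D := Finset.min'_mem D hDne
    have hl₀lt : (w s(p l₀.castSucc, p l₀.succ) : ℝ) < 1 := (Finset.mem_filter.1 hl₀D).2
    have hmin : ∀ l : Fin k, l < l₀ → w s(p l.castSucc, p l.succ) = 1 := by
      intro l hl
      by_contra hne
      have hlt : (w s(p l.castSucc, p l.succ) : ℝ) < 1 :=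
        lt_of_le_of_ne (w _).2.2 (fun h => hne (Set.Icc.coe_eq_one.1 h))
      have hlD : l ∈ D := Finset.mem_filter.2 ⟨Finset.mem_univ _, hlt⟩
      exact absurd (Finset.min'_le D l hlD) (not_le.2 (hl₀ ▸ hl))
    set e : Sym2 (Fin n) := s(p l₀.castSucc, p l₀.succ) with he
    have hehalf : (w e : ℝ) ≤ 1 / 2 := by
      rcases hhalf l₀ with h | h
      · exact h
      · exfalso; rw [h] at hl₀lt; norm_num at hl₀lt
    -- ### the OPEN branch: pin `e` to `1` and use the induction hypothesis
    set w₁ := pinW w ({e} : Set (Sym2 (Fin n))) ({e} : Set (Sym2 (Fin n))) with hw₁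
    have hw₁e : w₁ e = 1 := pinW_apply_of_mem_of_mem w (mem_singleton e) (mem_singleton e)
    have hw₁ne : ∀ i, i ≠ e → w₁ i = w i := fun i hi => pinW_apply_of_not_mem w _ (fun h => hi h)
    have hpath₁ : ∀ (i : Fin (k + 1)) (v : Fin n), v ∉ A → v ≠ p i → 0 < (w₁ s(p i, v) : ℝ) →
        ∃ l : Fin (k + 1), v = p l ∧ (l.val = i.val + 1 ∨ i.val = l.val + 1) := by
      intro i v hvA hvp hpos
      by_cases hie : s(p i, v) = e
      · rcases Sym2.eq_iff.1 hie with ⟨h1, h2⟩ | ⟨h1, h2⟩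
        · refine ⟨l₀.succ, h2, Or.inl ?_⟩
          have := congrArg Fin.val (hpinj h1); simp only [Fin.val_castSucc] at this; simp [this]
        · refine ⟨l₀.castSucc, h2, Or.inr ?_⟩
          have := congrArg Fin.val (hpinj h1); simp only [Fin.val_succ] at this; simp [this]
      · rw [hw₁ne _ hie] at hpos
        exact hpath i v hvA hvp hpos
    have hd₁ : (Finset.univ.filter fun l : Fin k => (w₁ s(p l.castSucc, p l.succ) : ℝ) < 1).card = d := by
      have hset : (Finset.univ.filter fun l : Fin k => (w₁ s(p l.castSucc, p l.succ) : ℝ) < 1) = D.erase l₀ := by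
        ext l
        simp only [hD, Finset.mem_filter, Finset.mem_univ, true_and, Finset.mem_erase]
        by_cases hl : l = l₀
        · subst hl
          rw [← he, hw₁e]
          simp
        · have hne : s(p l.castSucc, p l.succ) ≠ e := fun h => hl (chainPair_injective p hpinj (h.trans he.symm))
          rw [hw₁ne _ hne]
          simp [hl]
      rw [hset, Finset.card_erase_of_mem hl₀D, hd]
      rfl
    have hhalf₁ : ∀ l : Fin k, (w₁ s(p l.castSucc, p l.succ) : ℝ) ≤ 1 / 2 ∨ w₁ s(p l.castSucc, p l.succ) = 1 := by
      intro l
      by_cases hl : s(p l.castSucc, p l.succ) = e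
      · right; rw [hl, hw₁e]
      · rw [hw₁ne _ hl]; exact hhalf l
    obtain ⟨c₁, hc₁, hchamp₁⟩ := MergeStability.exists_champion (prodBernoulli w₁) A hA j
    have hIH := ih k w₁ p hpinj hpA hpath₁ hd₁ hhalf₁ c₁ hc₁ hchamp₁
    have hM₁ : (prodBernoulli w₁).real {ω : BondConfig (Fin n) | (A.filter fun z => ω ∈ openConn c₁ z).card ≤ j} ≤ M :=
      (light_pinOpen_le w A c₁ j e).trans (hchamp c₁ hc₁)
    have hopen : μ.real (bad ∩ {ω : BondConfig (Fin n) | e ∈ ω}) ≤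
        6 * μ.real (att ∩ {ω : BondConfig (Fin n) | e ∈ ω}) * M := by
      rw [real_inter_open_eq w bad e, real_inter_open_eq w att e]
      have hw0 : 0 ≤ (w e : ℝ) := (w e).2.1
      have hatt0 : 0 ≤ (prodBernoulli w₁).real att := measureReal_nonneg
      calc (w e : ℝ) * (prodBernoulli w₁).real bad
          ≤ (w e : ℝ) * (6 * (prodBernoulli w₁).real att *
              (prodBernoulli w₁).real {ω : BondConfig (Fin n) | (A.filter fun z => ω ∈ openConn c₁ z).card ≤ j}) :=
            mul_le_mul_of_nonneg_left hIH hw0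
        _ ≤ (w e : ℝ) * (6 * (prodBernoulli w₁).real att * M) := by
            refine mul_le_mul_of_nonneg_left (mul_le_mul_of_nonneg_left hM₁ (by positivity)) hw0
        _ = 6 * ((w e : ℝ) * (prodBernoulli w₁).real att) * M := by ring
    -- ### the CLOSED branch: delete `e`; the prefix up to `e` is a weight-one chain
    set w₀ := pinW w ({e} : Set (Sym2 (Fin n))) ∅ with hw₀
    have hw₀e : w₀ e = 0 := pinW_apply_of_mem_of_not_mem w (mem_singleton e) (Set.notMem_empty _)
    have hw₀ne : ∀ i, i ≠ e → w₀ i = w i := fun i hi => pinW_apply_of_not_mem w _ (fun h => hi h)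
    have hle : l₀.val + 1 ≤ k + 1 := by have := l₀.isLt; omega
    set p' : Fin (l₀.val + 1) → Fin n := fun i => p (Fin.castLE hle i) with hp'
    have hp'0 : p' 0 = p 0 := by simp [hp']
    have hp'inj : Function.Injective p' := fun i i' h => Fin.castLE_injective hle (hpinj h)
    have hp'A : ∀ i, p' i ∉ A := fun i => hpA _
    have hp'val : ∀ i : Fin (l₀.val + 1), (Fin.castLE hle i).val = i.val := fun i => rfl
    have hpath₀ : ∀ (i : Fin (l₀.val + 1)) (v : Fin n), v ∉ A → v ≠ p' i → 0 < (w₀ s(p' i, v) : ℝ) →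
        ∃ l : Fin (l₀.val + 1), v = p' l ∧ (l.val = i.val + 1 ∨ i.val = l.val + 1) := by
      intro i v hvA hvp hpos
      have hne : s(p' i, v) ≠ e := by
        intro h; rw [h, hw₀e] at hpos; simp at hpos
      rw [hw₀ne _ hne] at hpos
      obtain ⟨l, hvl, hl⟩ := hpath (Fin.castLE hle i) v hvA hvp hpos
      rw [hp'val] at hl
      -- `l ≤ l₀`: the only neighbour beyond the prefix would be across `e`
      have hlle : l.val ≤ l₀.val := by
        rcases hl with hl | hl
        · by_contra hgt
          have hleq : l.val = l₀.val + 1 := by have := i.isLt; omega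
          have hieq : i.val = l₀.val := by omega
          apply hne
          rw [he, hvl]
          have h1 : p' i = p l₀.castSucc := by
            simp only [hp']; congr 1; exact Fin.ext (by simp [hieq])
          have h2 : p l = p l₀.succ := by congr 1; exact Fin.ext (by simp [hleq])
          rw [h1, h2]
        · have := i.isLt; omega
      refine ⟨⟨l.val, by omega⟩, ?_, hl⟩
      rw [hvl]; simp only [hp']; congr 1
    have hone₀ : ∀ l : Fin l₀.val, w₀ s(p' l.castSucc, p' l.succ) = 1 := by
      intro l
      set m : Fin k := ⟨l.val, by have := l.isLt; have := l₀.isLt; omega⟩ with hm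
      have hml : m < l₀ := by rw [Fin.lt_def]; exact l.isLt
      have hpair : s(p' l.castSucc, p' l.succ) = s(p m.castSucc, p m.succ) := by
        simp only [hp']; congr 1
      have hne : s(p m.castSucc, p m.succ) ≠ e := fun h =>
        (ne_of_lt hml) (chainPair_injective p hpinj (h.trans he.symm))
      rw [hpair, hw₀ne _ hne]
      exact hmin m hml
    obtain ⟨c₀, hc₀, hchamp₀⟩ := MergeStability.exists_champion (prodBernoulli w₀) A hA j
    have hbase := condCIL_chain w₀ A j p' hp'inj hp'A hpath₀ hone₀ c₀ hc₀ hchamp₀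
    rw [hp'0] at hbase
    have hM₀ : (prodBernoulli w₀).real {ω : BondConfig (Fin n) | (A.filter fun z => ω ∈ openConn c₀ z).card ≤ j} ≤ 2 * M := by
      have h := ObserverUnionBoundG.pinW_single_real_mul_le w
        {ω : BondConfig (Fin n) | (A.filter fun z => ω ∈ openConn c₀ z).card ≤ j} e
      have hnn : 0 ≤ (prodBernoulli w₀).real
          {ω : BondConfig (Fin n) | (A.filter fun z => ω ∈ openConn c₀ z).card ≤ j} := measureReal_nonneg
      nlinarith [hchamp c₀ hc₀]
    have hclosed : μ.real (bad ∩ {ω : BondConfig (Fin n) | e ∉ ω}) ≤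
        6 * μ.real (att ∩ {ω : BondConfig (Fin n) | e ∉ ω}) * M := by
      rw [real_inter_closed_eq w bad e, real_inter_closed_eq w att e]
      have hw0 : 0 ≤ 1 - (w e : ℝ) := by linarith [(w e).2.2]
      have hatt0 : 0 ≤ (prodBernoulli w₀).real att := measureReal_nonneg
      calc (1 - (w e : ℝ)) * (prodBernoulli w₀).real bad
          ≤ (1 - (w e : ℝ)) * (3 * (prodBernoulli w₀).real att *
              (prodBernoulli w₀).real {ω : BondConfig (Fin n) | (A.filter fun z => ω ∈ openConn c₀ z).card ≤ j}) :=
            mul_le_mul_of_nonneg_left hbase hw0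
        _ ≤ (1 - (w e : ℝ)) * (3 * (prodBernoulli w₀).real att * (2 * M)) := by
            refine mul_le_mul_of_nonneg_left (mul_le_mul_of_nonneg_left hM₀ (by positivity)) hw0
        _ = 6 * ((1 - (w e : ℝ)) * (prodBernoulli w₀).real att) * M := by ring
    -- ### adding the two branches
    have hsplit : ∀ S : Set (BondConfig (Fin n)), μ.real S =
        μ.real (S ∩ {ω : BondConfig (Fin n) | e ∈ ω}) + μ.real (S ∩ {ω : BondConfig (Fin n) | e ∉ ω}) := by
      intro S
      have h := measureReal_inter_add_sdiff (μ := μ) (s := S) (t := {ω : BondConfig (Fin n) | e ∈ ω})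
        MeasurableSet.of_discrete
      have hdiff : S \ {ω : BondConfig (Fin n) | e ∈ ω} = S ∩ {ω : BondConfig (Fin n) | e ∉ ω} := by
        ext ω; simp only [mem_sdiff, mem_setOf_eq, mem_inter_iff]
      rw [hdiff] at h
      exact h.symm
    rw [hsplit bad, hsplit att]
    nlinarith [hopen, hclosed, measureReal_nonneg (μ := μ) (s := att ∩ {ω : BondConfig (Fin n) | e ∈ ω}),
      measureReal_nonneg (μ := μ) (s := att ∩ {ω : BondConfig (Fin n) | e ∉ ω})]

/-- **Conditional CIL along a Steiner path, `∃ a ∈ A` shape**, `A` nonempty. [this work] -/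
theorem condCIL_steinerPath_exists (w : Sym2 (Fin n) → unitInterval) (A : Finset (Fin n)) (j : ℕ) (hA : A.Nonempty)
    {k : ℕ} (p : Fin (k + 1) → Fin n) (hpinj : Function.Injective p) (hpA : ∀ i, p i ∉ A)
    (hpath : ∀ (i : Fin (k + 1)) (v : Fin n), v ∉ A → v ≠ p i → 0 < (w s(p i, v) : ℝ) →
      ∃ l : Fin (k + 1), v = p l ∧ (l.val = i.val + 1 ∨ i.val = l.val + 1))
    (hhalf : ∀ l : Fin k, (w s(p l.castSucc, p l.succ) : ℝ) ≤ 1 / 2 ∨ w s(p l.castSucc, p l.succ) = 1) :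
    ∃ a ∈ A, (prodBernoulli w).real {ω : BondConfig (Fin n) |
        1 ≤ (A.filter fun z => ω ∈ openConn (p 0) z).card ∧ (A.filter fun z => ω ∈ openConn (p 0) z).card ≤ j} ≤
      6 * (prodBernoulli w).real (⋃ a' ∈ A, (openConn (p 0) a' : Set (BondConfig (Fin n)))) *
        (prodBernoulli w).real {ω : BondConfig (Fin n) | (A.filter fun z => ω ∈ openConn a z).card ≤ j} := by
  obtain ⟨c, hc, hchamp⟩ := MergeStability.exists_champion (prodBernoulli w) A hA j
  exact ⟨c, hc, condCIL_steinerPath A j _ k w p hpinj hpA hpath rfl hhalf c hc hchamp⟩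

end CondCIL

end

end Summit.CriticalPhenomena.PercolationContinuityZ3.Theorems
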